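import Literature.Computability.Complexity.FKPointLocationFormsFP
import Literature.Computability.Complexity.CodeFPStrings
import HarnessLib

/-!
# Fournier–Koiran point location, XII: decoders and record surgery for the protocol machine

Topic `Literature/Computability/Complexity`, grouping namespace `FKPointLocation`. `CodeFP`
realisations (maps computed on codes by `FP` string functions, `CodeFP.lean`) of the low-level
pieces of the untyped location protocol of `FKPointLocationUntyped.lean` (Fournier–Koiran, ICALP
2000 = LIP RR-1999-21, §2.1: the state machine run by the oracle algorithm of Theorem 3), used by
the transition (`FKPointLocationUpdFP.lean`):

* the fixed-width decoders `chunkInt`, `udecodeForm`, `udecodeApex` (`strChunks`);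
* record surgery on the codes of `FKPointLocationEncoding.lean`: a field of a scratch / state is
  replaced with `List.set` on the raw list of pre-encoded fields (`setF`, `scr_setF`, `data_setF`,
  `scr_ofFields`, `data_ofFields`, `data_withCur`);
* the input record `(P, d, τ, b)` of the transition and its projections (`UIn`, `uinE`, `uin_*`);
* values: the fresh scratch `UScratch.init` (`scrInitFP`), options of naturals as raw lists.

## References

* H. Fournier, P. Koiran, *Lower bounds are not easier over the reals: inside PH*, ICALP 2000,
  LNCS 1853 = LIP RR-1999-21, §2.1 (Steps 1 and k), §2.2 (polynomial size), Thm 3 (p. 11: the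
  simulation is "tedious but completely straightforward"). [FournierKoiran2000]
* S. Arora, B. Barak, *Computational Complexity: A Modern Approach*, CUP 2009, §1.3. [AroraBarak2009]
-/

namespace Literature.Computability.Complexity

namespace FKPointLocation

open _root_.Computability CodeFP Polynomial

/-! ### Fixed-width decoders -/

section Decode

/-- `chunkInt` (sign bit, then magnitude) is computed in polynomial time. [folklore] -/
theorem chunkIntFP : CodeFP strE intE chunkInt := by
  have hhead : CodeFP strE bitE (fun c : List Bool => c.headD false) :=
    (strGetD.comp ((const strE 0).pair (CodeFP.id strE))).congr fun c => by
      cases c <;> rfl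
  have htail : CodeFP strE strE (fun c : List Bool => c.tail) :=
    (strDrop.comp ((const strE 1).pair (CodeFP.id strE))).congr fun c => by
      cases c <;> rfl
  have hval : CodeFP strE intE (fun c : List Bool => ((bitsToNat c.tail : ℕ) : ℤ)) := (intOfNat.comp (strVal.comp htail) :)
  exact ((hhead.ite (intNeg.comp hval) hval :)).congr fun c => by unfold chunkInt; rfl

/-- **`udecodeForm b D w` is computed in polynomial time** from `(1ᵇ, 1ᴰ, w)` (the `D` chunks of
`b+1` bits, `strChunks`, read by `chunkInt`). [cite: FournierKoiran2000, §2.1–2.2] -/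
theorem udecodeFormFP : CodeFP (pairE unE (pairE unE strE)) vecE (fun p => udecodeForm p.1 p.2.1 p.2.2) := by
  have hb : CodeFP (pairE unE (pairE unE strE)) unE (fun p => p.1 + 1) := (unSucc.comp (fst _ _) :)
  have hD : CodeFP (pairE unE (pairE unE strE)) unE (fun p => p.2.1) := (snd _ _).fst'
  have hw : CodeFP (pairE unE (pairE unE strE)) strE (fun p => p.2.2) := (snd _ _).snd'
  have hch := (strChunks.comp (hD.pair (hb.pair hw)) :)
  exact (((map₀ chunkIntFP).comp hch :)).congr fun p => by simp [udecodeForm, List.map_map, Function.comp_def]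

/-- **`udecodeApex W D w` is computed in polynomial time** from `(1ᵂ, 1ᴰ, w)`. [cite: FournierKoiran2000, §2.1–2.2] -/
theorem udecodeApexFP : CodeFP (pairE unE (pairE unE strE)) (pairE vecE natE) (fun p => udecodeApex p.1 p.2.1 p.2.2) := by
  have hW : CodeFP (pairE unE (pairE unE strE)) unE (fun p => p.1) := fst _ _
  have hD : CodeFP (pairE unE (pairE unE strE)) unE (fun p => p.2.1) := (snd _ _).fst'
  have hw : CodeFP (pairE unE (pairE unE strE)) strE (fun p => p.2.2) := (snd _ _).snd'
  have hdrop : CodeFP (pairE unE (pairE unE strE)) strE (fun p => p.2.2.drop p.1) := (strDrop.comp (hW.pair hw) :)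
  have htake : CodeFP (pairE unE (pairE unE strE)) strE (fun p => p.2.2.take p.1) := (strTake.comp (hW.pair hw) :)
  exact (((udecodeFormFP.comp (hW.pair (hD.pair hdrop))).pair (strVal.comp htake) :)).congr fun p => by rfl

end Decode

/-! ### Record surgery: replacing one laid-out field -/

section Surgery

variable {α : Type} {eα : α → List Bool}

/-- The raw field list of a computed scratch. [folklore] -/
theorem scr_fields {c : α → UScratch} (hc : CodeFP eα scrE c) : CodeFP eα (rawE strE) (fun a => scrFields (c a)) := by
  obtain ⟨f, hf, hfc⟩ := hc; exact ⟨f, hf, hfc⟩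

/-- The raw field list of a computed state. [folklore] -/
theorem data_fields {d : α → UData} (hd : CodeFP eα dataE d) : CodeFP eα (rawE strE) (fun a => dataFields (d a)) := by
  obtain ⟨f, hf, hfd⟩ := hd; exact ⟨f, hf, hfd⟩

/-- Replacing item `k` of a computed raw list of strings by a computed string. [cite: AroraBarak2009, §1.3] -/
theorem setF {g : α → List (List Bool)} {v : α → List Bool} (k : ℕ) (hg : CodeFP eα (rawE strE) g) (hv : CodeFP eα strE v) :
    CodeFP eα (rawE strE) (fun a => (g a).set k (v a)) :=
  ((rawSet strE).comp (hg.pair ((const eα k).pair hv)) :)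

/-- **Replacing field `k` of a computed scratch** by a computed pre-encoded value. [cite: AroraBarak2009, §1.3] -/
theorem scr_setF {c : α → UScratch} {v : α → List Bool} (k : ℕ) (hc : CodeFP eα scrE c) (hv : CodeFP eα strE v) :
    CodeFP eα (rawE strE) (fun a => (scrFields (c a)).set k (v a)) :=
  ((rawSet strE).comp ((scr_fields hc).pair ((const eα k).pair hv)) :)

/-- **Replacing field `k` of a computed state** by a computed pre-encoded value. [cite: AroraBarak2009, §1.3] -/
theorem data_setF {d : α → UData} {v : α → List Bool} (k : ℕ) (hd : CodeFP eα dataE d) (hv : CodeFP eα strE v) :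
    CodeFP eα (rawE strE) (fun a => (dataFields (d a)).set k (v a)) :=
  ((rawSet strE).comp ((data_fields hd).pair ((const eα k).pair hv)) :)

/-- Reading back a raw field list as a scratch code, along an identity of field lists. [folklore] -/
theorem scr_ofFields {g : α → List (List Bool)} {c : α → UScratch} (h : CodeFP eα (rawE strE) g)
    (he : ∀ a, g a = scrFields (c a)) : CodeFP eα scrE c := by
  obtain ⟨f, hf, hfg⟩ := h; exact ⟨f, hf, fun a => by rw [hfg, he]; rfl⟩

/-- Reading back a raw field list as a state code, along an identity of field lists. [folklore] -/
theorem data_ofFields {g : α → List (List Bool)} {d : α → UData} (h : CodeFP eα (rawE strE) g)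
    (he : ∀ a, g a = dataFields (d a)) : CodeFP eα dataE d := by
  obtain ⟨f, hf, hfg⟩ := h; exact ⟨f, hf, fun a => by rw [hfg, he]; rfl⟩

/-- Replacing the scratch of a computed state by a computed scratch. [folklore] -/
theorem data_withCur {d : α → UData} {c : α → UScratch} (hd : CodeFP eα dataE d) (hc : CodeFP eα scrE c) :
    CodeFP eα dataE (fun a => { d a with cur := c a }) :=
  data_ofFields (data_setF 4 hd (ofStrE hc)) fun _ => rfl

end Surgery

/-! ### The input of the transition and its projections -/

section Input

/-- The input of the transition: parameters, state, task, answer bit. [folklore] -/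
abbrev UIn : Type := UParams × UData × UTask × Bool

/-- Its code. [folklore] -/
abbrev uinE : UIn → List Bool := pairE paramsE (pairE dataE (pairE taskE bitE))

/-- Projection (parameters). [folklore] -/
theorem uin_P : CodeFP uinE paramsE (fun q : UIn => q.1) := fst _ _
/-- Projection (state). [folklore] -/
theorem uin_d : CodeFP uinE dataE (fun q : UIn => q.2.1) := (snd _ _).fst'
/-- Projection (task). [folklore] -/
theorem uin_τ : CodeFP uinE taskE (fun q : UIn => q.2.2.1) := (snd _ _).snd'.fst'
/-- Projection (answer bit). [folklore] -/
theorem uin_b : CodeFP uinE bitE (fun q : UIn => q.2.2.2) := (snd _ _).snd'.snd'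
/-- Projection (scratch). [folklore] -/
theorem uin_cur : CodeFP uinE scrE (fun q : UIn => q.2.1.cur) := (data_cur.comp uin_d :)
/-- Projection (chart). [folklore] -/
theorem uin_chart : CodeFP uinE vecE (fun q : UIn => q.2.1.chart) := (data_chart.comp uin_d :)
/-- Projection (task argument `j`). [folklore] -/
theorem uin_arg (j : ℕ) : CodeFP uinE natE (fun q : UIn => q.2.2.1.args.getD j 0) := ((task_arg j).comp uin_τ :)
/-- Projection (`D`, unary). [folklore] -/
theorem uin_D : CodeFP uinE unE (fun q : UIn => q.1.D) := (params_D.comp uin_P :)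
/-- Projection (`L`, unary). [folklore] -/
theorem uin_L : CodeFP uinE unE (fun q : UIn => q.1.L) := (params_L.comp uin_P :)
/-- Projection (`W`, unary). [folklore] -/
theorem uin_W : CodeFP uinE unE (fun q : UIn => q.1.W) := (params_W.comp uin_P :)
/-- Projection (`bB`, unary). [folklore] -/
theorem uin_bB : CodeFP uinE unE (fun q : UIn => q.1.bB) := (params_bB.comp uin_P :)
/-- Projection (`Wf`, unary). [folklore] -/
theorem uin_Wf : CodeFP uinE unE (fun q : UIn => q.1.Wf) := (params_Wf.comp uin_P :)
/-- Projection (`Wa`, unary). [folklore] -/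
theorem uin_Wa : CodeFP uinE unE (fun q : UIn => q.1.Wa) := (params_Wa.comp uin_P :)
/-- The answer bit as a singleton string. [folklore] -/
theorem uin_bStr : CodeFP uinE strE (fun q : UIn => [q.2.2.2]) := uin_b.recodeOut (eγ := strE) fun _ => rfl
/-- The extended prefix bits `bits ++ [b]`. [folklore] -/
theorem uin_bits' : CodeFP uinE strE (fun q : UIn => q.2.1.cur.bits ++ [q.2.2.2]) :=
  (strAppend.comp ((scr_bits.comp uin_cur).pair uin_bStr) :)

end Input

/-! ### Scratch values: the fresh scratch, options as raw lists -/

section Values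

variable {α : Type} {eα : α → List Bool}

/-- The all-`false` bit vector of a unary length. [folklore] -/
theorem falseVec : CodeFP unE (rawE bitE) (fun D => List.replicate D false) :=
  ((map₀ (const unitE false)).comp replicateUnit).congr fun D => by simp

/-- **The fresh scratch `UScratch.init D`** from `1ᴰ`. [folklore] -/
theorem scrInitFP : CodeFP unE scrE UScratch.init := by
  have h := scr_mk (eα := unE) (stSc := fun _ => (none : Option ℕ)) (stCh := fun _ => ([] : List (List ℤ)))
    zeroVec (const unE (0 : ℕ)) (const unE ([] : List (List ℤ))) (const unE false) (const unE ([] : List Bool))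
    (const unE (none : Option ℕ)) (const unE ([] : List (List ℤ))) zeroVec (const unE (1 : ℕ)) falseVec falseVec
    (const unE (none : Option ℕ)) (fun _ _ => rfl)
  exact h.congr fun D => rfl

/-- An option of naturals as the raw list of its elements (the code is the same). [folklore] -/
theorem optToRaw {o : α → Option ℕ} (h : CodeFP eα (optE natE) o) : CodeFP eα (rawE natE) (fun a => (o a).toList) := by
  obtain ⟨f, hf, hfo⟩ := h; exact ⟨f, hf, hfo⟩

/-- A raw list of length `≤ 1` of naturals read as an option code. [folklore] -/
theorem optOfRaw {l : α → List ℕ} {o : α → Option ℕ} (h : CodeFP eα (rawE natE) l) (he : ∀ a, l a = (o a).toList) :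
    CodeFP eα (optE natE) o := by
  obtain ⟨f, hf, hfl⟩ := h; exact ⟨f, hf, fun a => by rw [hfl, he]; rfl⟩

/-- `Option.isSome` of a computed option of naturals. [folklore] -/
theorem optIsSomeN {o : α → Option ℕ} (h : CodeFP eα (optE natE) o) : CodeFP eα bitE (fun a => (o a).isSome) :=
  ((rawIsEmpty natE).comp (optToRaw h)).not.congr fun a => by cases o a <;> rfl

/-- `Option.getD 0` of a computed option of naturals. [folklore] -/
theorem optGetD0 {o : α → Option ℕ} (h : CodeFP eα (optE natE) o) : CodeFP eα natE (fun a => (o a).getD 0) :=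
  ((rawGetD natE (d := 0) natE_zero).comp ((optToRaw h).pair (const eα 0))).congr fun a => by cases o a <;> rfl

/-- `some` of a computed natural. [folklore] -/
theorem optSomeN {n : α → ℕ} (h : CodeFP eα natE n) : CodeFP eα (optE natE) (fun a => some (n a)) :=
  optOfRaw ((rawSingleton natE).comp h) fun _ => rfl

end Values

end FKPointLocation

end Literature.Computability.Complexity
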